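import Literature.NumberTheory.LFunctions.GoldfeldSchinzelLowerHalfExplicit
import Literature.NumberTheory.LFunctions.PrimitiveQuadraticCharacterKronecker
import HarnessLib

/-!
# Table-free form of the class-summed repulsion: `Σ_Q 1/a_Q ≤ h(−d)/(N+1) + N/2`, hence
# `(1 − β)(1 + 5(1 − β)) > (6/π)·√(h(−d)/(2d))` and `h(−d) < 1.24·(1 − β)²·d` at every real zero

Topic `Literature/NumberTheory/LFunctions` (namespace `Literature.NumberTheory.LFunctions`, sub-namespace
`ClassSumRepulsion`). Everything in this file is PROVED (theorems only; no definition, no named fact, debt 0).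
Cell `parity-realchar` (SIEGEL INSTRUMENT): TARGET §2 row 16 ODD v5 and conditionals topics I.1 / I.17, the
`√h`-shape that needs no leading-coefficient table (so holds for every class number `h(−d)`, where
`RealZeroRepulsionOddClassNumberHundred.lean` stops at `h ≥ 101 ⇒ 10.49`).

* `card_fiber_le_succ` — the trivial census: at most `n` reduced forms of discriminant `D < 0` have leading
  coefficient `n` (`b ∈ (−n, n]` has the parity of `D`);
* `sum_inv_fst_le_linear` — **`Σ_{Q reduced} 1/a_Q ≤ h(D)/(N+1) + N/2` for every `N`** (rearrangement);
* `classNumber_lt_of_realZero_param` — at a real zero `β ∈ [9/10, 1)` of `L(s, χ)` (`χ` odd real primitive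
  mod `d > 4`): `h(−d) < A·(h(−d)/(N+1) + N/2)` for every `N`, `A = (1−β)(1+5(1−β))(π/6)√d`
  (`one_sub_realZero_mul_sum_gt_classNumber` of `GoldfeldSchinzelLowerHalfExplicit.lean`);
* with `N = ⌊√(2h)⌋`: `one_sub_realZero_mul_gt_sqrt_classNumber` —
  **`(1 − β)(1 + 5(1 − β)) > (6/π)·√(h(−d))/(√2·√d)`** (`6/(π√2) = 1.35…`): the repulsion GROWS like `√h`,
  explicitly and for every `h` (Ralaivaosaona–Razakarinoro's Theorem 2 has the better `h/log²h`, but only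
  asymptotically and with `2^{ω}`-counting); and the ceiling form `classNumber_lt_of_realZero_sq` —
  **`h(−d) < 1.24·(1 − β)²·d`** (`2(π/6)²·(1 + 5(1−β))² ≤ 2(π/6)²·2.25 < 1.24`): a real zero at distance
  `1 − β` from `1` forces `h(−d) < 1.24(1−β)²d`, against the I.1 line `h_K ≤ (1/π)(1−β)√d·log²d` — better
  exactly in the Goldfeld–Schinzel regime `1 − β < 0.26·log²d/√d`;
* field side `…_field` and the quality reading `classNumber_lt_of_isSiegelZero_sq`
  (`h(−d) < 1.24·d/(η² log²d)`).

LABEL (cell rule): row 16 / I.1 / I.17 kernel, hypothesis-free. WHAT THIS IS NOT: nothing for even characters;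
not the `h/log²h` shape; nothing here bears on parity (H5).

## References (context)

* [GoldfeldSchinzel1975] Theorem 1 (case `d < 0`).
* [RalaivaosaonaRazakarinoro2026] Theorem 2, Lemma 2.
* [Cox2013] §2.A (2.7), Thm. 7.7(ii).
* [TaoTeravainen2021] Definition 1.4.
-/

noncomputable section

open Complex Finset
open Literature.Barriers.Parity
open Literature.NumberTheory.QuadraticFields Literature.NumberTheory.QuadraticFields.Quadratic
open Literature.NumberTheory.QuadraticFields.BinaryQuadraticForm (reducedForms mem_reducedForms_iff
  classNumber_pos)
open Literature.NumberTheory.LFunctions.PrimitiveQuadratic (isFundamentalDiscriminant_neg)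

namespace Literature.NumberTheory.LFunctions

namespace ClassSumRepulsion

/-! ### The trivial census and the linear rearrangement bound -/

/-- **At most `n` reduced forms of discriminant `D < 0` have leading coefficient `n`**: such a form is
`(n, b, c)` with `b ∈ (−n, n]` of the parity of `D` (`b² ≡ D (mod 4)`), and `b ↦ ⌊(b + n + 1)/2⌋` is
injective on integers of one parity, into `[1, n]`. [cite: Cox2013, §2.A eq. (2.7)] -/
theorem card_fiber_le_succ {D : ℤ} (hD : D < 0) (k : ℕ) :
    ((reducedForms D).filter (fun Q => Q.1 = (k : ℤ) + 1)).card ≤ k + 1 := by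
  classical
  refine (BinaryQuadraticForm.LeadingCoeff.card_filter_fst_eq_le hD ((k : ℤ) + 1)).trans ?_
  have hcard : (Finset.Icc (1 : ℤ) ((k : ℤ) + 1)).card = k + 1 := by
    rw [Int.card_Icc]; omega
  rw [← hcard]
  refine Finset.card_le_card_of_injOn (fun b => (b + k + 2) / 2) (fun b hb => ?_) (fun b hb b' hb' h => ?_)
  · simp only [Finset.coe_filter, Set.mem_setOf_eq, Finset.mem_Ioc, Finset.coe_Icc, Set.mem_Icc] at hb ⊢
    obtain ⟨⟨h1, h2⟩, -⟩ := hb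
    omega
  · simp only [Finset.coe_filter, Set.mem_setOf_eq, Finset.mem_Ioc] at hb hb' h
    obtain ⟨⟨h1, h2⟩, hdvd⟩ := hb
    obtain ⟨⟨h1', h2'⟩, hdvd'⟩ := hb'
    -- parities: `b ≡ D ≡ b' (mod 2)`
    have h2dvd : (2 : ℤ) ∣ 4 * ((k : ℤ) + 1) := ⟨2 * ((k : ℤ) + 1), by ring⟩
    have hpar : ∀ x : ℤ, 4 * ((k : ℤ) + 1) ∣ x ^ 2 - D → (x % 2 = 0 ↔ D % 2 = 0) := by
      intro x hx
      have h2 : (2 : ℤ) ∣ x ^ 2 - D := dvd_trans h2dvd hx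
      have hx2 : (2 : ℤ) ∣ x ^ 2 - x := ⟨x * (x - 1) / 2 * 1, by
        have := Int.even_mul_pred_self x
        obtain ⟨r, hr⟩ := this
        rw [show x ^ 2 - x = x * (x - 1) by ring, hr, show r + r = 2 * r by ring]
        simp⟩
      have hxD : (2 : ℤ) ∣ x - D := by
        have : x - D = (x ^ 2 - D) - (x ^ 2 - x) := by ring
        rw [this]; exact dvd_sub h2 hx2
      omega
    have e1 := hpar b hdvd
    have e2 := hpar b' hdvd'
    omega

/-- `Σ_{k<N} (k + 1) = N(N+1)/2` over `ℝ`. [folklore] -/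
private theorem sum_range_succ_real (N : ℕ) :
    ∑ k ∈ Finset.range N, ((k : ℝ) + 1) = (N : ℝ) * ((N : ℝ) + 1) / 2 := by
  induction N with
  | zero => simp
  | succ n ih => rw [Finset.sum_range_succ, ih]; push_cast; ring

/-- **`Σ_{Q ∈ reducedForms D} 1/a_Q ≤ h(D)/(N+1) + N/2`** for every `D < 0` and every `N` (rearrangement with
the trivial census `#{a_Q = n} ≤ n`). [cite: RalaivaosaonaRazakarinoro2026, Lemma 2] -/
theorem sum_inv_fst_le_linear {D : ℤ} (hD : D < 0) (N : ℕ) :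
    ∑ Q ∈ reducedForms D, (1 : ℝ) / (Q.1 : ℝ) ≤
      (BinaryQuadraticForm.classNumber D : ℝ) / ((N : ℝ) + 1) + (N : ℝ) / 2 := by
  have ha : ∀ Q ∈ reducedForms D, (1 : ℤ) ≤ Q.1 := fun Q hQ => by
    obtain ⟨-, ha, -, -⟩ := (mem_reducedForms_iff hD).1 hQ; omega
  have h := BinaryQuadraticForm.LeadingCoeff.sum_one_div_le_of_card_fiber_le (reducedForms D) (fun Q => Q.1)
    ha N (fun k => k + 1) (fun k _ => card_fiber_le_succ hD k)
  have hc : ((reducedForms D).card : ℝ) = (BinaryQuadraticForm.classNumber D : ℝ) := rfl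
  rw [hc] at h
  have hsum : ∑ k ∈ Finset.range N, (((k + 1 : ℕ)) : ℝ) * (1 / ((k : ℝ) + 1) - 1 / ((N : ℝ) + 1)) = (N : ℝ) / 2 := by
    have e : ∀ k : ℕ, (((k + 1 : ℕ)) : ℝ) * (1 / ((k : ℝ) + 1) - 1 / ((N : ℝ) + 1)) =
        1 - ((k : ℝ) + 1) / ((N : ℝ) + 1) := by
      intro k
      have hk : (0 : ℝ) < (k : ℝ) + 1 := by positivity
      push_cast
      field_simp
    simp_rw [e]
    rw [Finset.sum_sub_distrib, Finset.sum_const, Finset.card_range, nsmul_eq_mul, mul_one,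
      ← Finset.sum_div, sum_range_succ_real]
    have hN : (0 : ℝ) < (N : ℝ) + 1 := by positivity
    field_simp
    ring
  rw [hsum] at h
  exact h

/-! ### At a real zero: the parametric and the `√h` forms -/

/-- **At a real zero `β ∈ [9/10, 1)`: `h(−d) < (1−β)(1+5(1−β))(π/6)√d · (h(−d)/(N+1) + N/2)` for every `N`.**
[cite: GoldfeldSchinzel1975, Theorem 1 (case d < 0)] -/
theorem classNumber_lt_of_realZero_param {d : ℕ} [NeZero d] (hd : 4 < d)
    {χ : DirichletCharacter ℂ d} (hprim : χ.IsPrimitive) (hquad : χ.IsQuadratic) (hodd : χ.Odd)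
    {β : ℝ} (hβ9 : 9 / 10 ≤ β) (hβ1 : β < 1) (hz : χ.LFunction β = 0) (N : ℕ) :
    (BinaryQuadraticForm.classNumber (-(d : ℤ)) : ℝ) <
      (1 - β) * (1 + 5 * (1 - β)) * (Real.pi / 6) * Real.sqrt d *
        ((BinaryQuadraticForm.classNumber (-(d : ℤ)) : ℝ) / ((N : ℝ) + 1) + (N : ℝ) / 2) := by
  have hD0 : (-(d : ℤ)) < 0 := by omega
  have hmain := one_sub_realZero_mul_sum_gt_classNumber hd hprim hquad hodd hβ9 hβ1 hz
  have hS := sum_inv_fst_le_linear hD0 N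
  have hδ0 : 0 < 1 - β := by linarith
  have hd4R : (4 : ℝ) < d := by exact_mod_cast hd
  have hsd0 : 0 < Real.sqrt d := Real.sqrt_pos.2 (by linarith)
  have hA : 0 ≤ (1 - β) * (1 + 5 * (1 - β)) * (Real.pi / 6) * Real.sqrt d := by
    have := Real.pi_pos; positivity
  have := mul_le_mul_of_nonneg_left hS hA
  nlinarith

/-- `−d ≡ 0, 1 (mod 4)` for the conductor of an odd real primitive character, so `h(−d) ≥ 1`.
[cite: MontgomeryVaughan2007, Theorem 9.13] -/
private theorem classNumber_pos_of_odd {d : ℕ} [NeZero d] (hd : 4 < d) {χ : DirichletCharacter ℂ d}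
    (hprim : χ.IsPrimitive) (hquad : χ.IsQuadratic) (hodd : χ.Odd) :
    0 < BinaryQuadraticForm.classNumber (-(d : ℤ)) := by
  have hD0 : (-(d : ℤ)) < 0 := by omega
  refine classNumber_pos hD0 ?_
  rcases isFundamentalDiscriminant_neg hprim hquad hodd with ⟨h1, -, -⟩ | ⟨h0, -, -⟩
  · exact Or.inr h1
  · exact Or.inl (Int.emod_eq_zero_of_dvd h0)

/-- **`(1 − β)(1 + 5(1 − β)) > (6/π)·√(h(−d))/(√2·√d)`** at every real zero `β ∈ [9/10, 1)` of `L(s, χ)`, `χ`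
the odd real primitive character mod `d > 4`: the parametric bound at `N = ⌊√(2h)⌋`, where
`h/(N+1) + N/2 < √(2h)`. [cite: GoldfeldSchinzel1975, Theorem 1 (case d < 0)]
[cite: RalaivaosaonaRazakarinoro2026, Theorem 2] -/
theorem one_sub_realZero_mul_gt_sqrt_classNumber {d : ℕ} [NeZero d] (hd : 4 < d)
    {χ : DirichletCharacter ℂ d} (hprim : χ.IsPrimitive) (hquad : χ.IsQuadratic) (hodd : χ.Odd)
    {β : ℝ} (hβ9 : 9 / 10 ≤ β) (hβ1 : β < 1) (hz : χ.LFunction β = 0) :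
    6 / Real.pi * Real.sqrt (BinaryQuadraticForm.classNumber (-(d : ℤ))) / (Real.sqrt 2 * Real.sqrt d) <
      (1 - β) * (1 + 5 * (1 - β)) := by
  set h : ℕ := BinaryQuadraticForm.classNumber (-(d : ℤ)) with hh
  have hpos : 0 < h := classNumber_pos_of_odd hd hprim hquad hodd
  have hhR : (1 : ℝ) ≤ (h : ℝ) := by exact_mod_cast hpos
  have hδ0 : 0 < 1 - β := by linarith
  have hd4R : (4 : ℝ) < d := by exact_mod_cast hd
  have hsd0 : 0 < Real.sqrt d := Real.sqrt_pos.2 (by linarith)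
  have hπ := Real.pi_pos
  set N : ℕ := Nat.sqrt (2 * h) with hN
  have hmain := classNumber_lt_of_realZero_param hd hprim hquad hodd hβ9 hβ1 hz N
  rw [← hh] at hmain
  set A : ℝ := (1 - β) * (1 + 5 * (1 - β)) * (Real.pi / 6) * Real.sqrt d with hA
  have hA0 : 0 < A := by rw [hA]; positivity
  -- `N ≤ √(2h) < N + 1`
  have hN1 : (N : ℝ) ^ 2 ≤ 2 * (h : ℝ) := by exact_mod_cast (hN ▸ Nat.sqrt_le' (2 * h))
  have hN2 : 2 * (h : ℝ) < ((N : ℝ) + 1) ^ 2 := by exact_mod_cast (hN ▸ Nat.lt_succ_sqrt' (2 * h))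
  set r : ℝ := Real.sqrt (2 * (h : ℝ)) with hr
  have hr0 : 0 < r := Real.sqrt_pos.2 (by positivity)
  have hrsq : r ^ 2 = 2 * (h : ℝ) := Real.sq_sqrt (by positivity)
  have hNr : (N : ℝ) ≤ r := by
    rw [hr]; exact (Real.le_sqrt (by positivity) (by positivity)).2 hN1
  have hrN : r < (N : ℝ) + 1 := by
    rw [hr, Real.sqrt_lt' (by positivity)]; exact hN2
  -- `h/(N+1) + N/2 < r/2 + r/2 = r`
  have hq1 : (h : ℝ) / ((N : ℝ) + 1) < r / 2 := by
    rw [div_lt_iff₀ (by positivity)]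
    nlinarith
  have hq2 : (N : ℝ) / 2 ≤ r / 2 := by linarith
  have hlt : (h : ℝ) < A * r := by
    calc (h : ℝ) < A * ((h : ℝ) / ((N : ℝ) + 1) + (N : ℝ) / 2) := hmain
      _ ≤ A * r := by nlinarith
  -- `h = (r²)/2 < A r` ⇒ `r < 2A` ⇒ `√h = r/√2 < √2·A`
  have hr2A : r < 2 * A := by nlinarith
  have hsqrt_h : Real.sqrt (h : ℝ) = r / Real.sqrt 2 := by
    rw [hr, Real.sqrt_mul' _ (by positivity : (0 : ℝ) ≤ (h : ℝ)), mul_comm]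
    have : Real.sqrt 2 ≠ 0 := by positivity
    field_simp
  rw [hsqrt_h]
  have hs2 : 0 < Real.sqrt 2 := by positivity
  have hs22 : Real.sqrt 2 * Real.sqrt 2 = 2 := Real.mul_self_sqrt (by norm_num)
  rw [div_lt_iff₀ (by positivity)]
  have e1 : 6 / Real.pi * (r / Real.sqrt 2) * Real.sqrt 2 = 6 * r / Real.pi := by
    field_simp
  have e2 : (1 - β) * (1 + 5 * (1 - β)) * (Real.sqrt 2 * Real.sqrt d) * Real.sqrt 2 = 12 * A / Real.pi := by
    calc (1 - β) * (1 + 5 * (1 - β)) * (Real.sqrt 2 * Real.sqrt d) * Real.sqrt 2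
        = (1 - β) * (1 + 5 * (1 - β)) * Real.sqrt d * (Real.sqrt 2 * Real.sqrt 2) := by ring
      _ = (1 - β) * (1 + 5 * (1 - β)) * Real.sqrt d * 2 := by rw [hs22]
      _ = 12 * A / Real.pi := by rw [hA]; field_simp; ring
  have key : 6 / Real.pi * (r / Real.sqrt 2) * Real.sqrt 2 <
      (1 - β) * (1 + 5 * (1 - β)) * (Real.sqrt 2 * Real.sqrt d) * Real.sqrt 2 := by
    rw [e1, e2]
    exact div_lt_div_of_pos_right (by linarith) hπ
  exact lt_of_mul_lt_mul_right key hs2.le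

/-- **`h(−d) < 1.24·(1 − β)²·d`** at every real zero `β ∈ [9/10, 1)` of `L(s, χ)`, `χ` the odd real primitive
character mod `d > 4` (`2(π/6)²(1 + 5(1−β))² ≤ 2·0.2742·2.25 < 1.24`). [cite: GoldfeldSchinzel1975, Theorem 1 (case d < 0)] -/
theorem classNumber_lt_of_realZero_sq {d : ℕ} [NeZero d] (hd : 4 < d)
    {χ : DirichletCharacter ℂ d} (hprim : χ.IsPrimitive) (hquad : χ.IsQuadratic) (hodd : χ.Odd)
    {β : ℝ} (hβ9 : 9 / 10 ≤ β) (hβ1 : β < 1) (hz : χ.LFunction β = 0) :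
    (BinaryQuadraticForm.classNumber (-(d : ℤ)) : ℝ) < 1.24 * (1 - β) ^ 2 * (d : ℝ) := by
  have h := one_sub_realZero_mul_gt_sqrt_classNumber hd hprim hquad hodd hβ9 hβ1 hz
  set hK : ℝ := (BinaryQuadraticForm.classNumber (-(d : ℤ)) : ℝ) with hhK
  have hh0 : 0 ≤ hK := by rw [hhK]; positivity
  have hδ0 : 0 < 1 - β := by linarith
  have hd4R : (4 : ℝ) < d := by exact_mod_cast hd
  have hd0 : (0 : ℝ) < d := by linarith
  have hsd0 : 0 < Real.sqrt d := Real.sqrt_pos.2 hd0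
  have hs2 : 0 < Real.sqrt 2 := by positivity
  have hπ := Real.pi_pos
  have hπ4 := Real.pi_lt_d4
  set X : ℝ := Real.sqrt 2 * Real.sqrt d with hX
  have hX0 : 0 < X := by rw [hX]; positivity
  have hXsq : X ^ 2 = 2 * d := by
    rw [hX, mul_pow, Real.sq_sqrt (by norm_num), Real.sq_sqrt hd0.le]
  -- `√hK < (π/6)·P·X` with `P = (1−β)(1+5(1−β)) ≤ 1.5(1−β)`
  rw [div_lt_iff₀ hX0] at h
  have h1 : Real.sqrt hK < Real.pi / 6 * ((1 - β) * (1 + 5 * (1 - β)) * X) := by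
    have := mul_lt_mul_of_pos_left h (by positivity : (0 : ℝ) < Real.pi / 6)
    have e : Real.pi / 6 * (6 / Real.pi * Real.sqrt hK) = Real.sqrt hK := by field_simp
    rwa [e] at this
  have hB : (1 - β) * (1 + 5 * (1 - β)) ≤ 1.5 * (1 - β) := by nlinarith
  set R : ℝ := Real.pi / 6 * (1.5 * (1 - β) * X) with hR
  have hR0 : 0 < R := by rw [hR]; positivity
  have h2 : Real.sqrt hK < R := by
    refine lt_of_lt_of_le h1 ?_
    rw [hR]
    exact mul_le_mul_of_nonneg_left (mul_le_mul_of_nonneg_right hB hX0.le) (by positivity)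
  have h3 : hK < R ^ 2 := (Real.sqrt_lt' hR0).1 h2
  have eR : R ^ 2 = (Real.pi / 6) ^ 2 * 2.25 * (1 - β) ^ 2 * (2 * d) := by
    rw [hR, show (Real.pi / 6 * (1.5 * (1 - β) * X)) ^ 2 = (Real.pi / 6) ^ 2 * 2.25 * (1 - β) ^ 2 * X ^ 2 by ring,
      hXsq]
  rw [eR] at h3
  have hπ6 : (Real.pi / 6) ^ 2 ≤ 0.2742 := by nlinarith
  have hnn : 0 ≤ (1 - β) ^ 2 * (2 * (d : ℝ)) := by positivity
  nlinarith

/-- **Quality reading: a Siegel zero of quality `η` at an odd `d ≥ 10⁴` forces `h(−d) < 1.24·d/(η log d)²`**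
(`1 − β₀ = 1/(η log d)`). [cite: TaoTeravainen2021, Definition 1.4] [cite: GoldfeldSchinzel1975, Theorem 1 (case d < 0)] -/
theorem classNumber_lt_of_isSiegelZero_sq {d : ℕ} [NeZero d] (hd : 10 ^ 4 ≤ d)
    {χ : DirichletCharacter ℂ d} {η : ℝ} (hS : IsSiegelZero χ η) (hodd : χ.Odd) :
    (BinaryQuadraticForm.classNumber (-(d : ℤ)) : ℝ) < 1.24 * (d : ℝ) / (η * Real.log d) ^ 2 := by
  obtain ⟨hprim, hquad, h10, hzero⟩ := hS
  have hdR : (10 : ℝ) ^ 4 ≤ d := by exact_mod_cast hd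
  have hlog : 1 < Real.log d := by
    rw [Real.lt_log_iff_exp_lt (by linarith)]
    have := Real.exp_one_lt_d9; linarith
  have hη0 : 0 < η := by linarith
  have hηlog : 10 < η * Real.log d := by nlinarith
  have hβ1 : 1 - 1 / (η * Real.log d) < 1 := by
    have : 0 < 1 / (η * Real.log d) := by positivity
    linarith
  have hβ9 : 9 / 10 ≤ 1 - 1 / (η * Real.log d) := by
    have : 1 / (η * Real.log d) ≤ 1 / 10 := by
      rw [div_le_div_iff₀ (by positivity) (by norm_num)]; linarith
    linarith
  have h := classNumber_lt_of_realZero_sq (by omega) hprim hquad hodd hβ9 hβ1 (by exact_mod_cast hzero)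
  rw [show (1 : ℝ) - (1 - 1 / (η * Real.log d)) = 1 / (η * Real.log d) by ring] at h
  have hpos : 0 < (η * Real.log d) ^ 2 := by positivity
  have e : 1.24 * (1 / (η * Real.log d)) ^ 2 * (d : ℝ) = 1.24 * (d : ℝ) / (η * Real.log d) ^ 2 := by
    field_simp
  rwa [e] at h

variable {K : Type*} [Field K] [NumberField K]

/-- **Field side: `h_K < 1.24·(1 − β)²·|d_K|`** at every real zero `β ∈ [9/10, 1)` of the Kronecker character's
`L`-function, `K` imaginary quadratic with `d_K = −d`, `d > 4`. [cite: Cox2013, §7.B Thm. 7.7(ii)]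
[cite: GoldfeldSchinzel1975, Theorem 1 (case d < 0)] -/
theorem classNumber_lt_of_realZero_sq_field (h2 : Module.finrank ℚ K = 2) {d : ℕ} [NeZero d]
    (hdK : NumberField.discr K = -(d : ℤ)) (hd : 4 < d) {χ : DirichletCharacter ℂ d}
    (hprim : χ.IsPrimitive) (hquad : χ.IsQuadratic) (hodd : χ.Odd)
    {β : ℝ} (hβ9 : 9 / 10 ≤ β) (hβ1 : β < 1) (hz : χ.LFunction β = 0) :
    (NumberField.classNumber K : ℝ) < 1.24 * (1 - β) ^ 2 * d := by
  have hdneg : NumberField.discr K < 0 := by rw [hdK]; omega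
  have hcard := card_reducedForms_eq_classNumber h2 hdneg
  rw [hdK] at hcard
  have := classNumber_lt_of_realZero_sq hd hprim hquad hodd hβ9 hβ1 hz
  rw [hcard] at this
  exact this

/-! ### Direction II reading: a large class number makes a zero-free interval (appended) -/

/-- **`h(−d) ≥ 1.24·(1 − σ)²·d ⇒ L(σ, χ) ≠ 0`** for `σ ∈ [9/10, 1)`, `χ` the odd real primitive character mod
`d > 4`: the contrapositive of `classNumber_lt_of_realZero_sq`. Equivalently `L(s, χ)` has no real zero in
`[max(9/10, 1 − √(h(−d)/(1.24 d))), 1)` — the Direction-II face of the class-summed repulsion (a class number of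
size `≍ √d` clears a window of width `≍ d^{−1/4}`). [cite: GoldfeldSchinzel1975, Theorem 1 (case d < 0)] -/
theorem LFunction_ne_zero_of_classNumber_ge_sq {d : ℕ} [NeZero d] (hd : 4 < d)
    {χ : DirichletCharacter ℂ d} (hprim : χ.IsPrimitive) (hquad : χ.IsQuadratic) (hodd : χ.Odd)
    {σ : ℝ} (hσ9 : 9 / 10 ≤ σ) (hσ1 : σ < 1)
    (hh : 1.24 * (1 - σ) ^ 2 * (d : ℝ) ≤ (BinaryQuadraticForm.classNumber (-(d : ℤ)) : ℝ)) :
    χ.LFunction σ ≠ 0 := by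
  intro hz
  have := classNumber_lt_of_realZero_sq hd hprim hquad hodd hσ9 hσ1 hz
  linarith

/-- **Zero-free window from the class number**: for `σ ∈ [9/10, 1)` with `(1 − σ)·√(1.24 d) ≤ √h(−d)`,
`L(σ, χ) ≠ 0`. [cite: GoldfeldSchinzel1975, Theorem 1 (case d < 0)] -/
theorem LFunction_ne_zero_of_sqrt_classNumber_ge {d : ℕ} [NeZero d] (hd : 4 < d)
    {χ : DirichletCharacter ℂ d} (hprim : χ.IsPrimitive) (hquad : χ.IsQuadratic) (hodd : χ.Odd)
    {σ : ℝ} (hσ9 : 9 / 10 ≤ σ) (hσ1 : σ < 1)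
    (hh : (1 - σ) * Real.sqrt (1.24 * d) ≤ Real.sqrt (BinaryQuadraticForm.classNumber (-(d : ℤ)))) :
    χ.LFunction σ ≠ 0 := by
  refine LFunction_ne_zero_of_classNumber_ge_sq hd hprim hquad hodd hσ9 hσ1 ?_
  have h0 : 0 ≤ (1 - σ) * Real.sqrt (1.24 * d) := by
    have : 0 ≤ Real.sqrt (1.24 * d) := Real.sqrt_nonneg _
    nlinarith
  have hsq := mul_self_le_mul_self h0 hh
  have hd0 : (0 : ℝ) ≤ 1.24 * d := by positivity
  rw [Real.mul_self_sqrt (by positivity), show (1 - σ) * Real.sqrt (1.24 * d) * ((1 - σ) * Real.sqrt (1.24 * d)) =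
    (1 - σ) ^ 2 * (Real.sqrt (1.24 * d) * Real.sqrt (1.24 * d)) by ring, Real.mul_self_sqrt hd0] at hsq
  linarith

/-- **Field side**: `h_K ≥ 1.24·(1 − σ)²·|d_K|` with `σ ∈ [9/10, 1)` ⇒ `L(σ, χ) ≠ 0` for the Kronecker character of
the imaginary quadratic field `K`, `d_K = −d`. [cite: GoldfeldSchinzel1975, Theorem 1 (case d < 0)]
[cite: Cox2013, §7.B Thm. 7.7(ii)] -/
theorem LFunction_ne_zero_of_classNumber_ge_sq_field (h2 : Module.finrank ℚ K = 2) {d : ℕ} [NeZero d]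
    (hdK : NumberField.discr K = -(d : ℤ)) (hd : 4 < d) {χ : DirichletCharacter ℂ d}
    (hprim : χ.IsPrimitive) (hquad : χ.IsQuadratic) (hodd : χ.Odd)
    {σ : ℝ} (hσ9 : 9 / 10 ≤ σ) (hσ1 : σ < 1)
    (hh : 1.24 * (1 - σ) ^ 2 * (d : ℝ) ≤ (NumberField.classNumber K : ℝ)) : χ.LFunction σ ≠ 0 := by
  intro hz
  have := classNumber_lt_of_realZero_sq_field h2 hdK hd hprim hquad hodd hσ9 hσ1 hz
  linarith


end ClassSumRepulsion

end Literature.NumberTheory.LFunctions
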